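import Summits.AtomisticToContinuum.Crystallization.Theorems.ExcessDecayLiouvilleHcpLiouvilleBlowdownDefs
import Summits.AtomisticToContinuum.Crystallization.Theorems.ExcessDecayLiouvilleLatticeParam

/-!
# `ExcessDecayLiouville.HcpLiouville` (stmt-AtomisticToContinuum-9332), line `Sketch` v4: the optical block is coercive, II

Part H3c of stub `stub_green`, lead file.  From the finite-volume optical inequality of part I,

`κ · #F · ‖ξ‖² ≤ #F · Q + 38 ‖ξ‖² · Σ_{x ∈ F} Σ'_{q ∈ S₀ ∖ F} dist(x,q)⁻⁸`  for every finite `F ⊆ S₀`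

(taken here as a hypothesis `hfv`, so that this file does not depend on part I), we let `F` run through the lattice
boxes `{t 0 + A z(a,b,c) : 0 ≤ a,b,c < N}`: the boundary sum is `≤ N³·C s₀⁻⁵ + 6 s₀ N²·K₈` (sites deeper than `s₀` see
the complement only beyond distance `(189/400) s₀`; the `≤ 6 s₀ N²` shallow sites see at most the whole lattice), and
`N → ∞`, `s₀ → ∞` give `κ ‖ξ‖² ≤ Q` (`Blowdown.optical_coercive_of_finite`).  All `[folklore]`; a `--supports` helper
for item stmt-AtomisticToContinuum-9332, nothing here closes an item.
-/

noncomputable section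

namespace Summit.AtomisticToContinuum.Crystallization.Theorems.ExcessDecayLiouville

open scoped BigOperators Topology Classical InnerProductSpace RealInnerProductSpace
open Literature.MathematicalPhysics.StatisticalMechanics
open Summit.AtomisticToContinuum.Crystallization.Theses.ExcessDecayLiouville
open Summit.AtomisticToContinuum.Crystallization.Theorems.PhononStabilityNegative

namespace Blowdown

section

variable {t : Fin 2 → EuclideanSpace ℝ (Fin 3)} {A : EuclideanSpace ℝ (Fin 3) →L[ℝ] EuclideanSpace ℝ (Fin 3)}

/-! ## Lattice boxes on sublattice `0` -/

/-- The box map `(a,b,c) ↦ t 0 + A z(a,b,c)` is injective for an admissible cell. [folklore] -/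
theorem boxMap_injective (hA : Adm₀ A) :
    Function.Injective (fun c : ℕ × ℕ × ℕ => t 0 + A (((c.1 : ℤ) : ℝ) • triangularVec₁ 1 +
      ((c.2.1 : ℤ) : ℝ) • triangularVec₂ 1 + ((c.2.2 : ℤ) : ℝ) • layerNormal (2 * Real.sqrt (2 / 3)))) := by
  intro c c' h
  have h1 := injective_of_adm₀ hA (add_left_cancel h)
  obtain ⟨ha, hb, hc⟩ := latticeCoords_eq h1
  ext <;> simp_all

/-- A site of sublattice `0` outside the box image has a lattice coordinate outside `[0, N)`. [folklore] -/
theorem coord_out_of_box (hA : Adm₀ A) {N : ℕ} {i j k : ℤ}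
    (hq : t 0 + A ((i : ℝ) • triangularVec₁ 1 + (j : ℝ) • triangularVec₂ 1 + (k : ℝ) • layerNormal (2 * Real.sqrt (2 / 3))) ∉
      ((Finset.range N ×ˢ Finset.range N ×ˢ Finset.range N).image (fun c : ℕ × ℕ × ℕ => t 0 +
        A (((c.1 : ℤ) : ℝ) • triangularVec₁ 1 + ((c.2.1 : ℤ) : ℝ) • triangularVec₂ 1 +
          ((c.2.2 : ℤ) : ℝ) • layerNormal (2 * Real.sqrt (2 / 3)))))) :
    (i < 0 ∨ (N : ℤ) ≤ i) ∨ (j < 0 ∨ (N : ℤ) ≤ j) ∨ (k < 0 ∨ (N : ℤ) ≤ k) := by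
  by_contra hcon
  push Not at hcon
  obtain ⟨⟨hi0, hiN⟩, ⟨hj0, hjN⟩, ⟨hk0, hkN⟩⟩ := hcon
  apply hq
  rw [Finset.mem_image]
  refine ⟨(i.toNat, j.toNat, k.toNat), ?_, ?_⟩
  · simp only [Finset.mem_product, Finset.mem_range]
    refine ⟨?_, ?_, ?_⟩ <;> omega
  · have hi : ((i.toNat : ℤ) : ℝ) = (i : ℝ) := by rw [Int.toNat_of_nonneg hi0]
    have hj : ((j.toNat : ℤ) : ℝ) = (j : ℝ) := by rw [Int.toNat_of_nonneg hj0]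
    have hk : ((k.toNat : ℤ) : ℝ) = (k : ℝ) := by rw [Int.toNat_of_nonneg hk0]
    have _ := hA
    simp only [hi, hj, hk]

/-- **Depth gives distance**: a box site at depth `≥ s₀` is at distance `≥ (189/400) s₀` from every site of sublattice
`0` outside the box. [folklore] -/
theorem dist_ge_of_deep (hA : Adm₀ A) {N s₀ : ℕ} {c : ℕ × ℕ × ℕ}
    (hc : c ∈ Finset.Ico s₀ (N - s₀) ×ˢ Finset.Ico s₀ (N - s₀) ×ˢ Finset.Ico s₀ (N - s₀))
    {q : EuclideanSpace ℝ (Fin 3)} (hq0 : ∃ z ∈ Λ₀, q = t 0 + A z)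
    (hqF : q ∉ ((Finset.range N ×ˢ Finset.range N ×ˢ Finset.range N).image (fun c : ℕ × ℕ × ℕ => t 0 +
        A (((c.1 : ℤ) : ℝ) • triangularVec₁ 1 + ((c.2.1 : ℤ) : ℝ) • triangularVec₂ 1 +
          ((c.2.2 : ℤ) : ℝ) • layerNormal (2 * Real.sqrt (2 / 3)))))) :
    (189 / 400 : ℝ) * s₀ ≤ dist (t 0 + A (((c.1 : ℤ) : ℝ) • triangularVec₁ 1 + ((c.2.1 : ℤ) : ℝ) • triangularVec₂ 1 +
      ((c.2.2 : ℤ) : ℝ) • layerNormal (2 * Real.sqrt (2 / 3)))) q := by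
  obtain ⟨z, ⟨i, j, k, rfl⟩, rfl⟩ := hq0
  have hout := coord_out_of_box (t := t) hA hqF
  simp only [Finset.mem_product, Finset.mem_Ico] at hc
  obtain ⟨⟨ha1, ha2⟩, ⟨hb1, hb2⟩, ⟨hc1, hc2⟩⟩ := hc
  -- the difference vector and its coordinates
  have hdist : dist (t 0 + A (((c.1 : ℤ) : ℝ) • triangularVec₁ 1 + ((c.2.1 : ℤ) : ℝ) • triangularVec₂ 1 +
      ((c.2.2 : ℤ) : ℝ) • layerNormal (2 * Real.sqrt (2 / 3))))
      (t 0 + A ((i : ℝ) • triangularVec₁ 1 + (j : ℝ) • triangularVec₂ 1 + (k : ℝ) • layerNormal (2 * Real.sqrt (2 / 3)))) =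
      ‖A ((((c.1 : ℤ) - i : ℤ) : ℝ) • triangularVec₁ 1 + (((c.2.1 : ℤ) - j : ℤ) : ℝ) • triangularVec₂ 1 +
        (((c.2.2 : ℤ) - k : ℤ) : ℝ) • layerNormal (2 * Real.sqrt (2 / 3)))‖ := by
    rw [dist_eq_norm, add_sub_add_left_eq_sub, ← map_sub]
    congr 2
    push_cast
    module
  rw [hdist]
  obtain ⟨hI1, hJ1, hK1⟩ := abs_coord_le_norm_apply_latticeVec hA ((c.1 : ℤ) - i) ((c.2.1 : ℤ) - j) ((c.2.2 : ℤ) - k)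
  have hs : (s₀ : ℝ) ≤ |(((c.1 : ℤ) - i : ℤ) : ℝ)| ∨ (s₀ : ℝ) ≤ |(((c.2.1 : ℤ) - j : ℤ) : ℝ)| ∨
      (s₀ : ℝ) ≤ |(((c.2.2 : ℤ) - k : ℤ) : ℝ)| := by
    rcases hout with (hi | hi) | (hj | hj) | (hk | hk)
    · left; rw [← Int.cast_abs]
      exact_mod_cast (show (s₀ : ℤ) ≤ |(c.1 : ℤ) - i| from le_abs.2 (Or.inl (by omega)))
    · left; rw [← Int.cast_abs]
      exact_mod_cast (show (s₀ : ℤ) ≤ |(c.1 : ℤ) - i| from le_abs.2 (Or.inr (by omega)))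
    · right; left; rw [← Int.cast_abs]
      exact_mod_cast (show (s₀ : ℤ) ≤ |(c.2.1 : ℤ) - j| from le_abs.2 (Or.inl (by omega)))
    · right; left; rw [← Int.cast_abs]
      exact_mod_cast (show (s₀ : ℤ) ≤ |(c.2.1 : ℤ) - j| from le_abs.2 (Or.inr (by omega)))
    · right; right; rw [← Int.cast_abs]
      exact_mod_cast (show (s₀ : ℤ) ≤ |(c.2.2 : ℤ) - k| from le_abs.2 (Or.inl (by omega)))
    · right; right; rw [← Int.cast_abs]
      exact_mod_cast (show (s₀ : ℤ) ≤ |(c.2.2 : ℤ) - k| from le_abs.2 (Or.inr (by omega)))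
  rcases hs with h | h | h
  · linarith
  · linarith
  · linarith

/-! ## The boundary sum over a box -/

/-- **Boundary estimate for a box**: with `T(x) = Σ'_{q ∈ S₀ ∖ F} dist(x,q)⁻⁸`, `F` the box of side `N` and `2 ≤ s₀`,
`2 s₀ ≤ N`: `Σ_{x ∈ F} T(x) ≤ N³ · 1024/((23/25)³((189/400)s₀)⁵) + (N³ − (N − 2s₀)³) · 1024/(23/25)⁸`. [folklore] -/
theorem box_boundary_le (hA : Adm₀ A) (hI : Inner₀ t A) {N s₀ : ℕ} (hs₀ : 2 ≤ s₀) (hN : 2 * s₀ ≤ N) :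
    ∑ x ∈ ((Finset.range N ×ˢ Finset.range N ×ˢ Finset.range N).image (fun c : ℕ × ℕ × ℕ => t 0 +
        A (((c.1 : ℤ) : ℝ) • triangularVec₁ 1 + ((c.2.1 : ℤ) : ℝ) • triangularVec₂ 1 +
          ((c.2.2 : ℤ) : ℝ) • layerNormal (2 * Real.sqrt (2 / 3))))),
      (∑' q : Sites₀ t A, (if (∃ z ∈ Λ₀, (q : EuclideanSpace ℝ (Fin 3)) = t 0 + A z) ∧
        (q : EuclideanSpace ℝ (Fin 3)) ∉ ((Finset.range N ×ˢ Finset.range N ×ˢ Finset.range N).image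
          (fun c : ℕ × ℕ × ℕ => t 0 + A (((c.1 : ℤ) : ℝ) • triangularVec₁ 1 + ((c.2.1 : ℤ) : ℝ) • triangularVec₂ 1 +
            ((c.2.2 : ℤ) : ℝ) • layerNormal (2 * Real.sqrt (2 / 3)))))
        then (dist x (q : EuclideanSpace ℝ (Fin 3)))⁻¹ ^ 8 else 0)) ≤
      (N : ℝ) ^ 3 * (1024 / ((23 / 25 : ℝ) ^ 3 * ((189 / 400 : ℝ) * s₀) ^ 5)) +
        ((N : ℝ) ^ 3 - ((N : ℝ) - 2 * s₀) ^ 3) * (1024 / ((23 / 25 : ℝ) ^ 3 * (23 / 25 : ℝ) ^ 5)) := by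
  classical
  set φ : ℕ × ℕ × ℕ → EuclideanSpace ℝ (Fin 3) := fun c => t 0 + A (((c.1 : ℤ) : ℝ) • triangularVec₁ 1 +
    ((c.2.1 : ℤ) : ℝ) • triangularVec₂ 1 + ((c.2.2 : ℤ) : ℝ) • layerNormal (2 * Real.sqrt (2 / 3))) with hφ
  set box : Finset (ℕ × ℕ × ℕ) := Finset.range N ×ˢ Finset.range N ×ˢ Finset.range N with hbox
  set inner : Finset (ℕ × ℕ × ℕ) := Finset.Ico s₀ (N - s₀) ×ˢ Finset.Ico s₀ (N - s₀) ×ˢ Finset.Ico s₀ (N - s₀) with hinner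
  set F : Finset (EuclideanSpace ℝ (Fin 3)) := box.image φ with hF
  set T : EuclideanSpace ℝ (Fin 3) → ℝ := fun x => ∑' q : Sites₀ t A, (if (∃ z ∈ Λ₀, (q : EuclideanSpace ℝ (Fin 3)) = t 0 + A z) ∧
    (q : EuclideanSpace ℝ (Fin 3)) ∉ F then (dist x (q : EuclideanSpace ℝ (Fin 3)))⁻¹ ^ 8 else 0) with hT
  have hinj : Function.Injective φ := boxMap_injective (t := t) hA
  have hφS : ∀ c, φ c ∈ Sites₀ t A := fun c => ⟨0, _, latticeVec_mem_Λ₀ _ _ _, rfl⟩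
  -- the two pointwise bounds
  have hT_le : ∀ (x : EuclideanSpace ℝ (Fin 3)) (R : ℝ), (23 / 25 : ℝ) ≤ R → x ∈ F →
      (∀ q : Sites₀ t A, (∃ z ∈ Λ₀, (q : EuclideanSpace ℝ (Fin 3)) = t 0 + A z) → (q : EuclideanSpace ℝ (Fin 3)) ∉ F →
        R ≤ dist x q) →
      T x ≤ 1024 / ((23 / 25 : ℝ) ^ 3 * R ^ 5) := by
    intro x R hR hx hfar
    refine le_trans ?_ (LevelOne.tsum_far_le hA hI x hR (k := 5) (by norm_num))
    refine Summable.tsum_le_tsum (fun q => ?_) ?_ (LevelOne.summable_far hA hI x hR (by norm_num))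
    · by_cases h1 : (∃ z ∈ Λ₀, (q : EuclideanSpace ℝ (Fin 3)) = t 0 + A z) ∧ (q : EuclideanSpace ℝ (Fin 3)) ∉ F
      · rw [if_pos h1, if_pos (by rw [dist_comm]; exact hfar q h1.1 h1.2), dist_comm]
      · rw [if_neg h1]; split_ifs <;> positivity
    · refine Summable.of_nonneg_of_le (fun q => by split_ifs <;> positivity) (fun q => ?_)
        (LevelOne.summable_far hA hI x hR (k := 5) (by norm_num))
      by_cases h1 : (∃ z ∈ Λ₀, (q : EuclideanSpace ℝ (Fin 3)) = t 0 + A z) ∧ (q : EuclideanSpace ℝ (Fin 3)) ∉ F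
      · rw [if_pos h1, if_pos (by rw [dist_comm]; exact hfar q h1.1 h1.2), dist_comm]
      · rw [if_neg h1]; split_ifs <;> positivity
  have hK₈ : ∀ c ∈ box, T (φ c) ≤ 1024 / ((23 / 25 : ℝ) ^ 3 * (23 / 25 : ℝ) ^ 5) := by
    intro c hc
    refine hT_le (φ c) (23 / 25) le_rfl (Finset.mem_image_of_mem φ hc) fun q _ hqF => ?_
    have hne : φ c ≠ q := fun h => hqF (h ▸ Finset.mem_image_of_mem φ hc)
    exact dist_sites_ge hA hI (hφS c) q.2 hne
  have hdeep : ∀ c ∈ inner, T (φ c) ≤ 1024 / ((23 / 25 : ℝ) ^ 3 * ((189 / 400 : ℝ) * s₀) ^ 5) := by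
    intro c hc
    have hcbox : c ∈ box := by
      simp only [hinner, hbox, Finset.mem_product, Finset.mem_Ico, Finset.mem_range] at hc ⊢
      omega
    have hR : (23 / 25 : ℝ) ≤ 189 / 400 * s₀ := by
      have : (2 : ℝ) ≤ s₀ := by exact_mod_cast hs₀
      linarith
    exact hT_le (φ c) _ hR (Finset.mem_image_of_mem φ hcbox) fun q hq0 hqF => dist_ge_of_deep hA hc hq0 hqF
  -- sum over the box, split into deep and shallow sites
  rw [Finset.sum_image fun c _ c' _ h => hinj h]
  have hsub : inner ⊆ box := by
    intro c hc
    simp only [hinner, hbox, Finset.mem_product, Finset.mem_Ico, Finset.mem_range] at hc ⊢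
    omega
  rw [← Finset.sum_sdiff hsub]
  have hTnn : ∀ x, 0 ≤ T x := fun x => tsum_nonneg fun q => by split_ifs <;> positivity
  have h1 : ∑ c ∈ box \ inner, T (φ c) ≤ ((box \ inner).card : ℝ) * (1024 / ((23 / 25 : ℝ) ^ 3 * (23 / 25 : ℝ) ^ 5)) := by
    rw [← nsmul_eq_mul, ← Finset.sum_const]
    exact Finset.sum_le_sum fun c hc => hK₈ c (Finset.mem_sdiff.1 hc).1
  have h2 : ∑ c ∈ inner, T (φ c) ≤ (inner.card : ℝ) * (1024 / ((23 / 25 : ℝ) ^ 3 * ((189 / 400 : ℝ) * s₀) ^ 5)) := by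
    rw [← nsmul_eq_mul, ← Finset.sum_const]
    exact Finset.sum_le_sum fun c hc => hdeep c hc
  have hcard_box : box.card = N ^ 3 := by
    simp only [hbox, Finset.card_product, Finset.card_range]; ring
  have hcard_inner : inner.card = (N - 2 * s₀) ^ 3 := by
    simp only [hinner, Finset.card_product, Nat.card_Ico]
    have : N - s₀ - s₀ = N - 2 * s₀ := by omega
    rw [this]; ring
  have hcard_diff : ((box \ inner).card : ℝ) = (N : ℝ) ^ 3 - ((N : ℝ) - 2 * s₀) ^ 3 := by
    rw [Finset.card_sdiff_of_subset hsub, hcard_box, hcard_inner, Nat.cast_sub, Nat.cast_pow, Nat.cast_pow, Nat.cast_sub (by omega)]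
    · push_cast; ring
    · exact Nat.pow_le_pow_left (by omega) 3
  have hinner_le : (inner.card : ℝ) ≤ (N : ℝ) ^ 3 := by
    rw [hcard_inner]; push_cast
    have h0 : (0 : ℝ) ≤ (N : ℝ) - 2 * s₀ := by
      have : ((2 * s₀ : ℕ) : ℝ) ≤ N := by exact_mod_cast hN
      push_cast at this; linarith
    rw [Nat.cast_sub (by omega)]
    push_cast
    exact pow_le_pow_left₀ h0 (by linarith [(Nat.cast_nonneg s₀ : (0 : ℝ) ≤ s₀)]) 3
  calc ∑ c ∈ box \ inner, T (φ c) + ∑ c ∈ inner, T (φ c)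
      ≤ ((box \ inner).card : ℝ) * (1024 / ((23 / 25 : ℝ) ^ 3 * (23 / 25 : ℝ) ^ 5)) +
          (inner.card : ℝ) * (1024 / ((23 / 25 : ℝ) ^ 3 * ((189 / 400 : ℝ) * s₀) ^ 5)) := add_le_add h1 h2
    _ ≤ ((N : ℝ) ^ 3 - ((N : ℝ) - 2 * s₀) ^ 3) * (1024 / ((23 / 25 : ℝ) ^ 3 * (23 / 25 : ℝ) ^ 5)) +
          (N : ℝ) ^ 3 * (1024 / ((23 / 25 : ℝ) ^ 3 * ((189 / 400 : ℝ) * s₀) ^ 5)) := by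
        rw [hcard_diff]
        gcongr
    _ = _ := by ring


/-! ## The limit `N → ∞`, `s₀ → ∞` -/

/-- `N³ − (N − 2s₀)³ ≤ 6 s₀ N²` for `2 s₀ ≤ N`. [folklore] -/
theorem cube_diff_le (N s₀ : ℝ) (hs : 0 ≤ s₀) (hN : 2 * s₀ ≤ N) : N ^ 3 - (N - 2 * s₀) ^ 3 ≤ 6 * s₀ * N ^ 2 := by
  nlinarith [mul_nonneg hs (sub_nonneg.2 hN), sq_nonneg s₀, mul_nonneg hs hs]

/-- **One box**: the finite-volume inequality on the box of side `N` with depth parameter `s₀` gives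
`κ ‖ξ‖² ≤ Q + 38 ‖ξ‖² (C' s₀⁻⁵ + 6 s₀ K₈ / N)`. [folklore] -/
theorem optical_box_le {κ : ℝ} (hA : Adm₀ A) (hI : Inner₀ t A) (ξ : EuclideanSpace ℝ (Fin 3)) (Q : ℝ)
    (hfv : ∀ F : Finset (EuclideanSpace ℝ (Fin 3)), (∀ x ∈ F, ∃ z ∈ Λ₀, x = t 0 + A z) →
      κ * F.card * ‖ξ‖ ^ 2 ≤ F.card * Q + 38 * ‖ξ‖ ^ 2 * ∑ x ∈ F,
        (∑' q : Sites₀ t A, (if (∃ z ∈ Λ₀, (q : EuclideanSpace ℝ (Fin 3)) = t 0 + A z) ∧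
          (q : EuclideanSpace ℝ (Fin 3)) ∉ F then (dist x (q : EuclideanSpace ℝ (Fin 3)))⁻¹ ^ 8 else 0)))
    {N s₀ : ℕ} (hs₀ : 2 ≤ s₀) (hN : 2 * s₀ ≤ N) (hN0 : 0 < N) :
    κ * ‖ξ‖ ^ 2 ≤ Q + 38 * ‖ξ‖ ^ 2 * (1024 / ((23 / 25 : ℝ) ^ 3 * ((189 / 400 : ℝ) * s₀) ^ 5) +
      6 * s₀ * (1024 / ((23 / 25 : ℝ) ^ 3 * (23 / 25 : ℝ) ^ 5)) / N) := by
  classical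
  set F : Finset (EuclideanSpace ℝ (Fin 3)) := (Finset.range N ×ˢ Finset.range N ×ˢ Finset.range N).image
    (fun c : ℕ × ℕ × ℕ => t 0 + A (((c.1 : ℤ) : ℝ) • triangularVec₁ 1 + ((c.2.1 : ℤ) : ℝ) • triangularVec₂ 1 + ((c.2.2 : ℤ) : ℝ) • layerNormal (2 * Real.sqrt (2 / 3)))) with hF
  have hF0 : ∀ x ∈ F, ∃ z ∈ Λ₀, x = t 0 + A z := by
    intro x hx
    rw [hF, Finset.mem_image] at hx
    obtain ⟨c, -, rfl⟩ := hx
    exact ⟨_, latticeVec_mem_Λ₀ _ _ _, rfl⟩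
  have hcard : (F.card : ℝ) = (N : ℝ) ^ 3 := by
    rw [hF, Finset.card_image_of_injective _ (boxMap_injective (t := t) hA)]
    simp only [Finset.card_product, Finset.card_range]; push_cast; ring
  have h1 := hfv F hF0
  have h2 := box_boundary_le (t := t) hA hI hs₀ hN
  rw [hcard] at h1
  have hN' : (0 : ℝ) < N := by exact_mod_cast hN0
  have hN3 : (0 : ℝ) < (N : ℝ) ^ 3 := by positivity
  have hs₀' : (0 : ℝ) ≤ s₀ := Nat.cast_nonneg _
  have hNs : (2 : ℝ) * s₀ ≤ N := by exact_mod_cast hN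
  have h3 := cube_diff_le (N : ℝ) s₀ hs₀' hNs
  set C₁ : ℝ := 1024 / ((23 / 25 : ℝ) ^ 3 * ((189 / 400 : ℝ) * s₀) ^ 5) with hC₁
  set K₈ : ℝ := 1024 / ((23 / 25 : ℝ) ^ 3 * (23 / 25 : ℝ) ^ 5) with hK₈
  have hC₁0 : 0 ≤ C₁ := by positivity
  have hK₈0 : 0 ≤ K₈ := by positivity
  have hξ : 0 ≤ 38 * ‖ξ‖ ^ 2 := by positivity
  -- combine: κ N³ ‖ξ‖² ≤ N³ Q + 38‖ξ‖² (N³ C₁ + 6 s₀ N² K₈)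
  have h4 : κ * (N : ℝ) ^ 3 * ‖ξ‖ ^ 2 ≤ (N : ℝ) ^ 3 * Q + 38 * ‖ξ‖ ^ 2 * ((N : ℝ) ^ 3 * C₁ + 6 * s₀ * (N : ℝ) ^ 2 * K₈) := by
    refine h1.trans (add_le_add le_rfl (mul_le_mul_of_nonneg_left (h2.trans ?_) hξ))
    nlinarith
  have h5 : κ * ‖ξ‖ ^ 2 ≤ Q + 38 * ‖ξ‖ ^ 2 * (C₁ + 6 * s₀ * K₈ / N) := by
    have key : κ * (N : ℝ) ^ 3 * ‖ξ‖ ^ 2 ≤ (N : ℝ) ^ 3 * (Q + 38 * ‖ξ‖ ^ 2 * (C₁ + 6 * s₀ * K₈ / N)) := by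
      refine h4.trans (le_of_eq ?_)
      field_simp
    have := div_le_div_of_nonneg_right key hN3.le
    rw [show κ * (N : ℝ) ^ 3 * ‖ξ‖ ^ 2 / (N : ℝ) ^ 3 = κ * ‖ξ‖ ^ 2 by field_simp,
      mul_div_cancel_left₀ _ hN3.ne'] at this
    exact this
  exact h5

/-- **The optical block is coercive** (hypothesis form): if the finite-volume optical inequality holds for every finite
set of sites of sublattice `0`, then `κ ‖ξ‖² ≤ Q`. [folklore] -/
theorem optical_coercive_of_finite {κ : ℝ} (hA : Adm₀ A) (hI : Inner₀ t A) (ξ : EuclideanSpace ℝ (Fin 3)) (Q : ℝ)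
    (hfv : ∀ F : Finset (EuclideanSpace ℝ (Fin 3)), (∀ x ∈ F, ∃ z ∈ Λ₀, x = t 0 + A z) →
      κ * F.card * ‖ξ‖ ^ 2 ≤ F.card * Q + 38 * ‖ξ‖ ^ 2 * ∑ x ∈ F,
        (∑' q : Sites₀ t A, (if (∃ z ∈ Λ₀, (q : EuclideanSpace ℝ (Fin 3)) = t 0 + A z) ∧
          (q : EuclideanSpace ℝ (Fin 3)) ∉ F then (dist x (q : EuclideanSpace ℝ (Fin 3)))⁻¹ ^ 8 else 0))) :
    κ * ‖ξ‖ ^ 2 ≤ Q := by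
  set K₈ : ℝ := 1024 / ((23 / 25 : ℝ) ^ 3 * (23 / 25 : ℝ) ^ 5) with hK₈
  set C' : ℝ := 1024 / ((23 / 25 : ℝ) ^ 3 * (189 / 400 : ℝ) ^ 5) with hC'
  have hK₈0 : 0 ≤ K₈ := by positivity
  have hC'0 : 0 ≤ C' := by positivity
  have hξ : 0 ≤ 38 * ‖ξ‖ ^ 2 := by positivity
  -- first limit: `N → ∞` at fixed depth
  have hdepth : ∀ s₀ : ℕ, 2 ≤ s₀ → κ * ‖ξ‖ ^ 2 ≤ Q + 38 * ‖ξ‖ ^ 2 * (C' / (s₀ : ℝ) ^ 5) := by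
    intro s₀ hs₀
    refine le_of_forall_pos_le_add fun ε hε => ?_
    set D : ℝ := 38 * ‖ξ‖ ^ 2 * (6 * s₀ * K₈) with hD
    have hD0 : 0 ≤ D := by positivity
    obtain ⟨N, hN1, hN2⟩ : ∃ N : ℕ, 2 * s₀ ≤ N ∧ D / ε ≤ N := by
      refine ⟨max (2 * s₀) (⌈D / ε⌉₊), le_max_left _ _, ?_⟩
      exact (Nat.le_ceil _).trans (by exact_mod_cast le_max_right _ _)
    have hN0 : 0 < N := by omega
    have hNpos : (0 : ℝ) < N := by exact_mod_cast hN0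
    have h := optical_box_le hA hI ξ Q hfv hs₀ hN1 hN0
    have hCeq : 1024 / ((23 / 25 : ℝ) ^ 3 * ((189 / 400 : ℝ) * s₀) ^ 5) = C' / (s₀ : ℝ) ^ 5 := by
      rw [hC', mul_pow]; field_simp
    rw [hCeq] at h
    have hDN : 38 * ‖ξ‖ ^ 2 * (6 * s₀ * K₈ / N) ≤ ε := by
      rw [show 38 * ‖ξ‖ ^ 2 * (6 * ↑s₀ * K₈ / ↑N) = D / N by rw [hD]; ring]
      rw [div_le_iff₀ hNpos]
      calc D = D / ε * ε := by field_simp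
        _ ≤ N * ε := mul_le_mul_of_nonneg_right hN2 hε.le
        _ = ε * N := mul_comm _ _
    calc κ * ‖ξ‖ ^ 2 ≤ Q + 38 * ‖ξ‖ ^ 2 * (C' / (s₀ : ℝ) ^ 5 + 6 * s₀ * K₈ / N) := h
      _ = Q + 38 * ‖ξ‖ ^ 2 * (C' / (s₀ : ℝ) ^ 5) + 38 * ‖ξ‖ ^ 2 * (6 * s₀ * K₈ / N) := by ring
      _ ≤ Q + 38 * ‖ξ‖ ^ 2 * (C' / (s₀ : ℝ) ^ 5) + ε := add_le_add le_rfl hDN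
  -- second limit: depth to infinity
  refine le_of_forall_pos_le_add fun ε hε => ?_
  set D : ℝ := 38 * ‖ξ‖ ^ 2 * C' with hD
  have hD0 : 0 ≤ D := by positivity
  obtain ⟨s₀, hs1, hs2⟩ : ∃ s₀ : ℕ, 2 ≤ s₀ ∧ D / ε ≤ s₀ := by
    refine ⟨max 2 (⌈D / ε⌉₊), le_max_left _ _, ?_⟩
    exact (Nat.le_ceil _).trans (by exact_mod_cast le_max_right _ _)
  have hspos : (0 : ℝ) < s₀ := by exact_mod_cast (show 0 < s₀ by omega)
  have hs1' : (1 : ℝ) ≤ s₀ := by exact_mod_cast (show 1 ≤ s₀ by omega)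
  have h := hdepth s₀ hs1
  have hpow : (s₀ : ℝ) ≤ (s₀ : ℝ) ^ 5 := by
    calc (s₀ : ℝ) = (s₀ : ℝ) ^ 1 := (pow_one _).symm
      _ ≤ (s₀ : ℝ) ^ 5 := pow_le_pow_right₀ hs1' (by norm_num)
  have hDs : 38 * ‖ξ‖ ^ 2 * (C' / (s₀ : ℝ) ^ 5) ≤ ε := by
    rw [show 38 * ‖ξ‖ ^ 2 * (C' / (s₀ : ℝ) ^ 5) = D / (s₀ : ℝ) ^ 5 by rw [hD]; ring]
    calc D / (s₀ : ℝ) ^ 5 ≤ D / s₀ := div_le_div_of_nonneg_left hD0 hspos hpow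
      _ ≤ ε := by
          rw [div_le_iff₀ hspos]
          calc D = D / ε * ε := by field_simp
            _ ≤ s₀ * ε := mul_le_mul_of_nonneg_right hs2 hε.le
            _ = ε * s₀ := mul_comm _ _
  linarith


/-- Registered sub-goal carrying this file (crux stmt-AtomisticToContinuum-9332, line `Sketch` v4, part H3c of
`stub_green`): the box limit of the finite-volume optical inequality. [folklore] -/
theorem _root_.Summit.AtomisticToContinuum.Crystallization.Theorems.ExcessDecayLiouville.blowdown_opticalLimit :
    ∀ (κ : ℝ) (t : Fin 2 → EuclideanSpace ℝ (Fin 3)) (A : EuclideanSpace ℝ (Fin 3) →L[ℝ] EuclideanSpace ℝ (Fin 3)), Adm₀ A → Inner₀ t A → ∀ (ξ : EuclideanSpace ℝ (Fin 3)) (Q : ℝ), (∀ F : Finset (EuclideanSpace ℝ (Fin 3)), (∀ x ∈ F, ∃ z ∈ Λ₀, x = t 0 + A z) → κ * F.card * ‖ξ‖ ^ 2 ≤ F.card * Q + 38 * ‖ξ‖ ^ 2 * ∑ x ∈ F, (∑' q : Sites₀ t A, (if (∃ z ∈ Λ₀, (q : EuclideanSpace ℝ (Fin 3)) = t 0 +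 A z) ∧ (q : EuclideanSpace ℝ (Fin 3)) ∉ F then (dist x (q : EuclideanSpace ℝ (Fin 3)))⁻¹ ^ 8 else 0))) → κ * ‖ξ‖ ^ 2 ≤ Q :=
  fun _ _ _ hA hI ξ Q hfv => optical_coercive_of_finite hA hI ξ Q hfv

end

end Blowdown

end Summit.AtomisticToContinuum.Crystallization.Theorems.ExcessDecayLiouville

end
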